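import Summits.ABC.StewartYu.ArchG3RecLinesClosed
import Summits.ABC.StewartYu.ArchG3RecSiegelAtoms
import Summits.ABC.StewartYu.ArchG3RecEndNum
import HarnessLib

/-!
# The archimedean record `ArchG3Rec` — letter lines in closed form, file A: the SCHEDULE SIDE CONDITIONS of the four families

Support file (theorems only; no named facts). Cell `abc-stewartyu`, route `YuMatveevShapeRat`, crux r2 `ArchCoreRat`
(stmt-ABC-20502), line `arch-g3-frame`, seam (B) of `stub_recLinesArch` (plan R46/R47: p5 g9's interface
`ArchG3Rec.LinesClosed`, p572686; record owner p1 proves `linesClosed_holds`). This file discharges the order/node side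
conditions of `KStepLinesR` / `OddStepLinesR` / `HalfStepLinesR` from the schedule laws of `ArchG3RecA`/`ArchG3RecSched`:
* `side_kstep (lev ν) (hν : ν < n)` — `1 ≤ T lev`, `Tf lev (ν+1) + T lev ≤ Tf lev ν` (indeed `=`), `Nf lev (ν+1) ≤ 3·Nf lev ν + 2`;
* `side_half (lev) (hlev : lev < Ŝ)` — `1 ≤ T lev`, `Tf (lev+1) 0 + T lev ≤ Tf lev n`, `2·Nh (lev+1) ≤ 6·Nf lev n + 5`;
* `side_odd (lev)` — `1 ≤ Nh lev`, `1 ≤ T lev`, `Tf lev 1 + T lev ≤ Tf lev 0`, `Nf lev 1 ≤ 6·Nh lev`;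
and records the real-valued node/order facts the lines use: `Nf_real`, `Tf_zero_zero_le` (`T₀ ≤ 17(n+1)L + (n+1)Ŝ`),
`T_le_Tf` (`T lev ≤ Tf lev ν`), `gain_ge` (`(2·Nf lev ν + 1)·T lev·G ≥ 8·2^ν·Z`, from `zeros_ge`).

## References
* [Nesterenko2003] Yu. V. Nesterenko, LNM 1819 (2003) — §4 (4.3)–(4.5), Prop. 4.1, §4.2–4.3.
-/

noncomputable section

open Finset Real

namespace Summit.ABC.StewartYu

namespace ArchG3Rec

open ArchG3Par (G K G_eq eight_le_G G_pos one_le_K K_pos)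

variable {n : ℕ} (P : ArchG3Rec n)

/-! ### Side conditions -/

/-- **k-step side conditions at `(lev, ν) → (lev, ν+1)`, `ν < n`.** [cite: Nesterenko2003, (4.3)–(4.5)] -/
theorem side_kstep (lev ν : ℕ) (hν : ν < n) :
    1 ≤ P.T lev ∧ P.Tf lev (ν + 1) + P.T lev ≤ P.Tf lev ν ∧ P.Nf lev (ν + 1) ≤ 3 * P.Nf lev ν + 2 := by
  refine ⟨(P.T_facts lev).1, ?_, (P.Nf_facts lev ν).2.1⟩
  unfold Tf
  rw [P.Mord_sub_succ lev ν hν.le]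

/-- **half-step side conditions at `(lev, n) → (lev+1, 0)`, `lev < Ŝ`.** [cite: Nesterenko2003, (4.3)–(4.5)] -/
theorem side_half (lev : ℕ) (hlev : lev < P.Sd) :
    1 ≤ P.T lev ∧ P.Tf (lev + 1) 0 + P.T lev ≤ P.Tf lev n ∧ 2 * P.Nh (lev + 1) ≤ 6 * P.Nf lev n + 5 := by
  refine ⟨(P.T_facts lev).1, ?_, P.two_Nh_succ_le lev⟩
  unfold Tf
  rw [P.Mord_sub_succ lev n le_rfl, P.Mord_level lev (by omega)]

/-- **odd-node k-step side conditions at `(lev, 0) → (lev, 1)`.** [cite: Nesterenko2003, (4.3)–(4.5)] -/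
theorem side_odd (lev : ℕ) :
    1 ≤ P.Nh lev ∧ 1 ≤ P.T lev ∧ P.Tf lev 1 + P.T lev ≤ P.Tf lev 0 ∧ P.Nf lev 1 ≤ 6 * P.Nh lev := by
  refine ⟨?_, (P.T_facts lev).1, ?_, ?_⟩
  · unfold Nh; exact (P.Xs_cap_facts lev).1
  · unfold Tf
    rw [P.Mord_sub_succ lev 0 (Nat.zero_le _)]
  · unfold Nf Nh; omega

/-! ### Real-valued node and order facts -/

/-- `Nf lev ν = 2^ν·Xs lev` (real) and `1 ≤ Xs lev`. [folklore] -/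
theorem Nf_real (lev ν : ℕ) : (P.Nf lev ν : ℝ) = 2 ^ ν * P.Xs lev ∧ (1 : ℝ) ≤ P.Xs lev := by
  refine ⟨by unfold Nf; push_cast; ring, by exact_mod_cast (P.Xs_cap_facts lev).1⟩

/-- `T lev ≤ Tf lev ν` for `ν ≤ n` (`Mord lev ν ≥ (n+1−ν)·T lev ≥ T lev`). [folklore] -/
theorem T_le_Tf (lev ν : ℕ) (hν : ν ≤ n) : P.T lev ≤ P.Tf lev ν := by
  have h := (P.Mord_facts lev ν).2
  have h1 : 1 ≤ n + 1 - ν := by omega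
  unfold Tf
  calc P.T lev = 1 * P.T lev := (one_mul _).symm
    _ ≤ (n + 1 - ν) * P.T lev := Nat.mul_le_mul_right _ h1
    _ ≤ P.Mord lev ν := h

/-- **the START order `T₀ = Tf 0 0 ≤ 17(n+1)·L + (n+1)·Ŝ`** (lp-1's `Mord_zero_le`, `1/(n+2)³ ≤ 1/16`). [folklore] -/
theorem Tf_zero_zero_le : (P.Tf 0 0 : ℝ) ≤ 17 * ((n : ℝ) + 1) * P.L + ((n : ℝ) + 1) * P.Sd := by
  have h := P.Mord_zero_le
  have hL : (0 : ℝ) ≤ P.L := Nat.cast_nonneg _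
  have hn : (0 : ℝ) ≤ n := Nat.cast_nonneg _
  have hn1 : (1 : ℝ) ≤ n := by exact_mod_cast P.hn
  have h27 : (27 : ℝ) ≤ ((n : ℝ) + 2) ^ 3 := by
    have h3 : (3 : ℝ) ≤ (n : ℝ) + 2 := by linarith
    nlinarith [pow_le_pow_left₀ (by norm_num : (0:ℝ) ≤ 3) h3 3]
  have h3 : 1 / ((n : ℝ) + 2) ^ 3 ≤ 1 / 27 := div_le_div_of_nonneg_left zero_le_one (by norm_num) h27
  unfold Tf
  have h4 : 16 * ((n : ℝ) + 1) * P.L * (1 + 1 / ((n : ℝ) + 2) ^ 3) ≤ 16 * ((n : ℝ) + 1) * P.L * (1 + 1 / 27) :=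
    mul_le_mul_of_nonneg_left (by linarith) (by positivity)
  nlinarith

/-- **the gain of one step dominates `8·2^ν·Z`**: `8·2^ν·Z ≤ (2·Nf lev ν + 1)·T lev·G`… in the form the (F) line carries it:
`8·2^ν·Z ≤ ((2·Nf lev ν + 1)·T lev : ℕ)·G + G·(2·Nf lev ν + 1)` (from `zeros_ge`: `zeros = G·2Nf·(T+1)`). [cite: Nesterenko2003, (4.25)] -/
theorem gain_ge (lev ν : ℕ) :
    8 * 2 ^ ν * P.Z ≤ (((2 * P.Nf lev ν + 1) * P.T lev : ℕ) : ℝ) * G n + G n * (2 * (P.Nf lev ν : ℝ) + 1) := by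
  have h := P.zeros_ge lev ν
  have hG := (G_pos n).le
  unfold zeros at h
  obtain ⟨e, _⟩ := P.Nf_real lev ν
  have hT : (0 : ℝ) ≤ P.T lev := Nat.cast_nonneg _
  push_cast
  rw [e]
  have e2 : (2 : ℝ) ^ (ν + 1) * P.Xs lev = 2 * (2 ^ ν * P.Xs lev) := by rw [pow_succ]; ring
  rw [e2] at h
  nlinarith

end ArchG3Rec

end Summit.ABC.StewartYu
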